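import Literature.Analysis.ODE.SoninEnvelope
import HarnessLib

/-!
# The Sonin–Pólya energy bounded by its limit at an end of the line

Topic `Literature/Analysis/ODE` (namespace `Literature.Analysis.ODE`), a complement to `SoninEnvelope.lean`
(`soninEnergy_antitoneOn` / `soninEnergy_monotoneOn`: `E = φ|u|² + |u′|²` is monotone where `φ` is). For a
solution of `u″ = −φ u` given through its DATA AT INFINITY — `‖u‖ → 1`, `‖u′‖ → |σ|`, `φ → σ²` as
`x → −∞` (the horizon-normalised solution of a radial wave equation in the tortoise variable), or the
mirror data at `+∞` — the monotone energy is bounded by its LIMIT: if `φ` is non-increasing on a left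
half-line `(−∞, b]` then `φ(s)|u(s)|² + |u′(s)|² ≤ 2σ²` for every `s ≤ b`; in particular `|u′(s)|² ≤ 2σ²`
wherever `φ(s) ≥ 0` and `|u(s)|² ≤ 2σ²/φ(s)` wherever `φ(s) > 0` — SHARP a priori bounds (no loss in any
large parameter) on the oscillatory cap preceding a barrier:

* `soninEnergy_le_of_tendsto_atBot` — `φ′ ≤ 0` on `(−∞, b]` and `E → E₀` at `−∞` give `E(s) ≤ E₀`
  for `s ≤ b`; `soninEnergy_le_of_tendsto_atTop` — the mirror (`φ′ ≥ 0` on `[b, ∞)`, limit at `+∞`);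
* `tendsto_soninEnergy_of_data` — the limit `E₀ = 2σ²` from `‖u‖ → 1`, `‖u′‖ → |σ|`, `φ → σ²`
  (any filter);
* `soninEnergy_le_two_mul_sq_of_horizon_data` — the assembled statement at `−∞`, with the
  consequences `‖u′ s‖² ≤ 2σ²` (`φ s ≥ 0`) and `φ(s)‖u s‖² ≤ 2σ²`, in the `−(φ·u)` form of the equation
  used by the Kerr files.

Elementary (monotonicity + `ge_of_tendsto`); all proved.

## References
* G. Szegő, *Orthogonal Polynomials*, AMS Colloquium Publ. 23, 4th ed. (1975), §7.31, Thm 7.31.1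
  (Sonin–Pólya). Folklore.
-/

noncomputable section

open Set Filter Topology

namespace Literature.Analysis.ODE

/-- **Monotone energy bounded by its limit at `−∞`.** If `u″ = −φu` with `φ′ ≤ 0` pointwise on
`(−∞, b]` and `φ|u|² + |u′|² → E₀` as `x → −∞`, then `φ(s)|u(s)|² + |u′(s)|² ≤ E₀` for every `s ≤ b`.
[folklore] -/
theorem soninEnergy_le_of_tendsto_atBot {u u' : ℝ → ℂ} {φ φ' : ℝ → ℝ} {b E₀ : ℝ}
    (h : ∀ x, x ≤ b → HasDerivAt u (u' x) x ∧ HasDerivAt u' (-(φ x : ℂ) * u x) x ∧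
      HasDerivAt φ (φ' x) x)
    (hφ' : ∀ x, x ≤ b → φ' x ≤ 0)
    (hlim : Tendsto (fun x ↦ φ x * ‖u x‖ ^ 2 + ‖u' x‖ ^ 2) atBot (𝓝 E₀)) {s : ℝ} (hs : s ≤ b) :
    φ s * ‖u s‖ ^ 2 + ‖u' s‖ ^ 2 ≤ E₀ := by
  refine ge_of_tendsto hlim ?_
  filter_upwards [eventually_le_atBot s] with t ht
  exact soninEnergy_le_of_le (α := t) (β := s) (fun x hx ↦ h x (hx.2.trans hs))
    (fun x hx ↦ hφ' x (hx.2.trans hs)) (left_mem_Icc.2 ht) (right_mem_Icc.2 ht) ht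

/-- **Monotone energy bounded by its limit at `+∞`.** If `u″ = −φu` with `φ′ ≥ 0` pointwise on
`[b, ∞)` and `φ|u|² + |u′|² → E₀` as `x → +∞`, then `φ(s)|u(s)|² + |u′(s)|² ≤ E₀` for every `s ≥ b`.
[folklore] -/
theorem soninEnergy_le_of_tendsto_atTop {u u' : ℝ → ℂ} {φ φ' : ℝ → ℝ} {b E₀ : ℝ}
    (h : ∀ x, b ≤ x → HasDerivAt u (u' x) x ∧ HasDerivAt u' (-(φ x : ℂ) * u x) x ∧
      HasDerivAt φ (φ' x) x)
    (hφ' : ∀ x, b ≤ x → 0 ≤ φ' x)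
    (hlim : Tendsto (fun x ↦ φ x * ‖u x‖ ^ 2 + ‖u' x‖ ^ 2) atTop (𝓝 E₀)) {s : ℝ} (hs : b ≤ s) :
    φ s * ‖u s‖ ^ 2 + ‖u' s‖ ^ 2 ≤ E₀ := by
  refine ge_of_tendsto hlim ?_
  filter_upwards [eventually_ge_atTop s] with t ht
  exact soninEnergy_le_of_ge (α := s) (β := t) (fun x hx ↦ h x (hs.trans hx.1))
    (fun x hx ↦ hφ' x (hs.trans hx.1)) (left_mem_Icc.2 ht) (right_mem_Icc.2 ht) ht

/-- **The limit of the energy from the data**: `‖u‖ → 1`, `‖u′‖ → |σ|`, `φ → σ²` along a filter `l`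
give `φ|u|² + |u′|² → 2σ²` along `l`. [folklore] -/
theorem tendsto_soninEnergy_of_data {u u' : ℝ → ℂ} {φ : ℝ → ℝ} {σ : ℝ} {l : Filter ℝ}
    (hu : Tendsto (fun x ↦ ‖u x‖) l (𝓝 1)) (hu' : Tendsto (fun x ↦ ‖u' x‖) l (𝓝 |σ|))
    (hφ : Tendsto φ l (𝓝 (σ ^ 2))) :
    Tendsto (fun x ↦ φ x * ‖u x‖ ^ 2 + ‖u' x‖ ^ 2) l (𝓝 (2 * σ ^ 2)) := by
  have h1 : Tendsto (fun x ↦ φ x * ‖u x‖ ^ 2) l (𝓝 (σ ^ 2 * 1 ^ 2)) := hφ.mul (hu.pow 2)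
  have h2 : Tendsto (fun x ↦ ‖u' x‖ ^ 2) l (𝓝 (|σ| ^ 2)) := hu'.pow 2
  have h := h1.add h2
  rw [one_pow, mul_one, sq_abs, ← two_mul] at h
  exact h

/-- **Sharp cap bounds for the horizon-data solution.** Let `u″ = −(φ·u)` on `ℝ` (the `−(φ u)` form of
the Kerr files), `φ` differentiable with `φ′ ≤ 0` on `(−∞, b]`, and let `‖u‖ → 1`, `‖u′‖ → |σ|`,
`φ → σ²` at `−∞`. Then for every `s ≤ b`: `φ(s)‖u s‖² + ‖u′ s‖² ≤ 2σ²`; hence `‖u′ s‖² ≤ 2σ²` if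
`φ(s) ≥ 0`, and `φ(s)‖u s‖² ≤ 2σ²`. [folklore] -/
theorem soninEnergy_le_two_mul_sq_of_horizon_data {u u' : ℝ → ℂ} {φ φ' : ℝ → ℝ} {b σ : ℝ}
    (hu : ∀ x, HasDerivAt u (u' x) x ∧ HasDerivAt u' (-((φ x : ℂ) * u x)) x)
    (hφd : ∀ x, x ≤ b → HasDerivAt φ (φ' x) x) (hφ' : ∀ x, x ≤ b → φ' x ≤ 0)
    (h0 : Tendsto (fun x ↦ ‖u x‖) atBot (𝓝 1)) (h1 : Tendsto (fun x ↦ ‖u' x‖) atBot (𝓝 |σ|))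
    (hφ : Tendsto φ atBot (𝓝 (σ ^ 2))) {s : ℝ} (hs : s ≤ b) :
    φ s * ‖u s‖ ^ 2 + ‖u' s‖ ^ 2 ≤ 2 * σ ^ 2 ∧ (0 ≤ φ s → ‖u' s‖ ^ 2 ≤ 2 * σ ^ 2) ∧
      φ s * ‖u s‖ ^ 2 ≤ 2 * σ ^ 2 := by
  have h : ∀ x, x ≤ b → HasDerivAt u (u' x) x ∧ HasDerivAt u' (-(φ x : ℂ) * u x) x ∧
      HasDerivAt φ (φ' x) x := fun x hx ↦
    ⟨(hu x).1, ((hu x).2).congr_deriv (neg_mul _ _).symm, hφd x hx⟩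
  have key := soninEnergy_le_of_tendsto_atBot h hφ' (tendsto_soninEnergy_of_data h0 h1 hφ) hs
  refine ⟨key, fun hφ0 ↦ ?_, ?_⟩
  · have : 0 ≤ φ s * ‖u s‖ ^ 2 := mul_nonneg hφ0 (sq_nonneg _)
    linarith
  · linarith [sq_nonneg ‖u' s‖]

end Literature.Analysis.ODE

end
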